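/-
Copyright (c) 2026 the pub-hodgecm-mathlib formalisation cell (harness21).  Prover seat hodgecm-mathlib-K2E3-p25 (g2), HCML Track B «K2-LIT»,
h413 = `stmt-HodgeConjecture-24833`, unit U12 «Characters», PART «RANK» leaf (11-2qs-Id′) → (qs2-ps) «van Dijk₂», brick D119 (CLS₂-fun), FILE 1 (group-generic recipe).
2026-09-04.
-/
import Mathlib.Analysis.Complex.Basic
import Mathlib.MeasureTheory.Constructions.BorelSpace.Complex
import Mathlib.Algebra.Group.Conj
import HarnessLib

/-!
# K2_E3 road (h413), (qs2-ps) «van Dijk₂», brick D119 (CLS₂-fun), FILE 1 — THE GROUP-GENERIC RECIPE: class functions on the regular «hyperbolic» set from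
# `W`-symmetric functions on a torus

Cell `pub/hodgecm-mathlib` (D-0151), Track B, seat K2E3-p25 (g2).  `--supports stmt-HodgeConjecture-24833 --as helper`; THEOREMS ONLY (no `def`, no instance, no notation,
no `sorry`); Mathlib-only imports.  COUNT-NEUTRAL.  This is ★ `K2E3HyperbolicClassFunOfTorus` (K2E3-p11 (g3), `N = 3`) §§2–4 with the group `U(Φ₃)(L⁺_v)` replaced by ANY
topological group: FILE 2 instantiates it on `G₂ = U(1,1)(L⁺_v)` (and the `N = 3` file is the instance `G₃`).

THE MATHEMATICS ([HarishChandra1970, Part I §3 Lemmas 19–20, Part V §3 Thm. 12, Lemma 42]; [Rogawski1990, §12.5 p. 182]; [vanDijk1972, §2]).  DATA: a topological group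
`G`, a subgroup `T` («torus»), a set `R ⊆ T` of «regular» elements, a self-map `w` of `T` («the Weyl element»), and the «hyperbolic set»
`Ω = {x ∈ G ∣ ∃ t ∈ R, t ~ x}`.  HYPOTHESES: (a) FIBRE DICHOTOMY `t, t′ ∈ R`, `t ~ t′ ⇒ t′ ∈ {t, w t}`; (b) HARISH-CHANDRA OPENNESS: for `t₀ ∈ R`, `c ∈ G` and
`V ∈ 𝓝 t₀` the conjugates `x s x⁻¹` (`s ∈ V ∩ R`) form a neighbourhood of `c t₀ c⁻¹`; (c) (for the bound) the classes meeting a compact `K` have regular representatives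
in a compact `C ⊆ T`.  RECIPE: for `ψ : T → ℂ` with `ψ(w t) = ψ(t)` on `R`, `N(x) = ψ(t_x)` (`x ∈ Ω`, `t_x ∈ R` any chosen conjugate), `N(x) = 0` (`x ∉ Ω`).  THEN (§1–§3):
`Ω` is open; `N = ψ` on `R`; `N` is conjugation invariant; continuous at the points of `Ω`; MEASURABLE (`ψ` continuous); bounded on compacts under (c); package
**`exists_classFun_of_recipe`**.

HONEST LABEL: HC_CM is proved only modulo the 7 printed citations (2 remaining named inputs: hLiu418 = stmt-HodgeConjecture-24832, h413 = stmt-HodgeConjecture-24833) until rung 0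
closes; count-neutral helper.

## References
* [HarishChandra1970] Harish-Chandra (notes by G. van Dijk), *Harmonic Analysis on Reductive p-adic Groups*, LNM 162 (1970), Part I §3 Lemmas 19–20; Part V §3 Thm. 12; Lemma 42.
* [Rogawski1990] J. D. Rogawski, *Automorphic Representations of Unitary Groups in Three Variables*, Ann. of Math. Stud. 123 (1990), §12.5 p. 182, §1.6 p. 6.
* [vanDijk1972] G. van Dijk, *Computation of certain induced characters of 𝔭-adic groups*, Math. Ann. 199 (1972), §2.
-/

set_option autoImplicit false
set_option linter.dupNamespace false

noncomputable section

open Set Filter Topology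

namespace Summit.HodgeConjecture.HodgeConjecture.Cruxes.H413.K2E3HyperbolicClassFunRecipe

variable {G : Type*} [Group G] [TopologicalSpace G] {T : Subgroup G} (R : Set ↥T) (w : ↥T → ↥T)
  (hdich : ∀ t t' : ↥T, t ∈ R → t' ∈ R → IsConj (t : G) (t' : G) → t' = t ∨ t' = w t)
  (hopen : ∀ t₀ : ↥T, t₀ ∈ R → ∀ (c : G) (V : Set ↥T), V ∈ 𝓝 t₀ →
    {g : G | ∃ (x : G) (s : ↥T), s ∈ V ∧ s ∈ R ∧ g = x * (s : G) * x⁻¹} ∈ 𝓝 (c * (t₀ : G) * c⁻¹))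
  (ψ : ↥T → ℂ) (hψw : ∀ t : ↥T, t ∈ R → ψ (w t) = ψ t)
  (N : G → ℂ)
  (hN : ∀ (x : G) (h : x ∈ {x : G | ∃ t : ↥T, t ∈ R ∧ IsConj (t : G) x}), N x = ψ h.choose)
  (hN0 : ∀ x : G, x ∉ {x : G | ∃ t : ↥T, t ∈ R ∧ IsConj (t : G) x} → N x = 0)

/-! ## §1 The hyperbolic set `Ω = {x ∣ ∃ t ∈ R, t ~ x}` is open and conjugation-saturated -/

include hopen in
/-- **`Ω` IS OPEN** (from the openness hypothesis (b) with `V = T`). [cite: HarishChandra1970, Part I §3 Lemma 20] [cite: Rogawski1990, §12.5 p. 182] -/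
theorem isOpen_conjRegularSet : IsOpen {x : G | ∃ t : ↥T, t ∈ R ∧ IsConj (t : G) x} := by
  rw [isOpen_iff_mem_nhds]
  rintro γ₀ ⟨t₀, hreg₀, hconj⟩
  obtain ⟨c, hc⟩ := isConj_iff.1 hconj
  have h := hopen t₀ hreg₀ c univ univ_mem
  rw [hc] at h
  refine mem_of_superset h ?_
  rintro g ⟨x, s, -, hs, rfl⟩
  exact ⟨s, hs, isConj_iff.2 ⟨x, rfl⟩⟩

omit [TopologicalSpace G] in
/-- `Ω` is conjugation-saturated. [folklore] -/
theorem conj_mem_conjRegularSet_iff (x h : G) :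
    h * x * h⁻¹ ∈ {x : G | ∃ t : ↥T, t ∈ R ∧ IsConj (t : G) x} ↔ x ∈ {x : G | ∃ t : ↥T, t ∈ R ∧ IsConj (t : G) x} := by
  constructor
  · rintro ⟨t, hreg, hconj⟩
    exact ⟨t, hreg, hconj.trans (isConj_iff.2 ⟨h⁻¹, by group⟩)⟩
  · rintro ⟨t, hreg, hconj⟩
    exact ⟨t, hreg, hconj.trans (isConj_iff.2 ⟨h, rfl⟩)⟩

/-! ## §2 The recipe: torus values, conjugation invariance, continuity on `Ω`, measurability, bounds -/

omit [TopologicalSpace G] in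
include hdich hψw hN in
/-- **TORUS VALUES**: if `t ∈ R` is conjugate to `x` then `N x = ψ t` (the chosen conjugate is `t` or `w t` by (a), and `ψ` is `w`-symmetric).
[cite: HarishChandra1970, Lemma 42] [cite: Rogawski1990, §12.5 p. 182] -/
theorem apply_eq_of_isConj (t : ↥T) (hreg : t ∈ R) (x : G) (hx : IsConj (t : G) x) : N x = ψ t := by
  have h : x ∈ {x : G | ∃ t : ↥T, t ∈ R ∧ IsConj (t : G) x} := ⟨t, hreg, hx⟩
  rw [hN x h]
  obtain ⟨hreg', hconj'⟩ := h.choose_spec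
  rcases hdich t h.choose hreg hreg' (hx.trans hconj'.symm) with h1 | h2
  · rw [h1]
  · rw [h2, hψw t hreg]

omit [TopologicalSpace G] in
include hdich hψw hN in
/-- **TORUS VALUES ON `R`**: `N t = ψ t`. [cite: Rogawski1990, §12.5 p. 182] -/
theorem apply_coe_eq (t : ↥T) (hreg : t ∈ R) : N (t : G) = ψ t :=
  apply_eq_of_isConj R w hdich ψ hψw N hN t hreg _ (IsConj.refl _)

omit [TopologicalSpace G] in
include hdich hψw hN hN0 in
/-- **CONJUGATION INVARIANCE** on all of `G`. [cite: Rogawski1990, §1.6 p. 6] -/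
theorem apply_conj_eq (x h : G) : N (h * x * h⁻¹) = N x := by
  by_cases hx : x ∈ {x : G | ∃ t : ↥T, t ∈ R ∧ IsConj (t : G) x}
  · obtain ⟨t, hreg, hconj⟩ := hx
    rw [apply_eq_of_isConj R w hdich ψ hψw N hN t hreg x hconj,
      apply_eq_of_isConj R w hdich ψ hψw N hN t hreg (h * x * h⁻¹) (hconj.trans (isConj_iff.2 ⟨h, rfl⟩))]
  · rw [hN0 x hx, hN0 _ (mt (conj_mem_conjRegularSet_iff R x h).1 hx)]

include hdich hopen hψw hN in
/-- **CONTINUITY AT THE POINTS OF `Ω`** (`ψ` continuous). [cite: HarishChandra1970, Part I §3 Lemma 20; Part V §3 Thm. 12] -/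
theorem continuousAt_of_mem (hψ : Continuous ψ) {γ₀ : G} (hγ₀ : γ₀ ∈ {x : G | ∃ t : ↥T, t ∈ R ∧ IsConj (t : G) x}) : ContinuousAt N γ₀ := by
  obtain ⟨t₀, hreg₀, hconj⟩ := hγ₀
  obtain ⟨c, hc⟩ := isConj_iff.1 hconj
  rw [ContinuousAt, tendsto_def]
  intro s hs
  rw [apply_eq_of_isConj R w hdich ψ hψw N hN t₀ hreg₀ γ₀ hconj] at hs
  have hV : ψ ⁻¹' s ∈ 𝓝 t₀ := hψ.continuousAt.preimage_mem_nhds hs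
  have h := hopen t₀ hreg₀ c _ hV
  rw [hc] at h
  refine mem_of_superset h ?_
  rintro g ⟨x, t, htV, htreg, rfl⟩
  show N _ ∈ s
  rw [apply_eq_of_isConj R w hdich ψ hψw N hN t htreg _ (isConj_iff.2 ⟨x, rfl⟩)]
  exact htV

include hdich hopen hψw hN hN0 in
/-- **MEASURABILITY** (`ψ` continuous): `N` is continuous on the open `Ω` and `0` off it. [cite: Rogawski1990, §1.6 p. 6; §12.5 p. 182] -/
theorem measurable_of_recipe [MeasurableSpace G] [BorelSpace G] (hψ : Continuous ψ) : Measurable N := by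
  have hΩ := isOpen_conjRegularSet R hopen
  refine measurable_of_isOpen fun U hU => ?_
  have hA : IsOpen {x : G | x ∈ {x : G | ∃ t : ↥T, t ∈ R ∧ IsConj (t : G) x} ∧ N x ∈ U} := by
    rw [isOpen_iff_mem_nhds]
    rintro x ⟨hxΩ, hxU⟩
    have h1 : N ⁻¹' U ∈ 𝓝 x := (continuousAt_of_mem R w hdich hopen ψ hψw N hN hψ hxΩ).preimage_mem_nhds (hU.mem_nhds hxU)
    filter_upwards [h1, hΩ.mem_nhds hxΩ] with y hy hyΩ using ⟨hyΩ, hy⟩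
  by_cases h0 : (0 : ℂ) ∈ U
  · have heq : N ⁻¹' U = {x : G | x ∈ {x : G | ∃ t : ↥T, t ∈ R ∧ IsConj (t : G) x} ∧ N x ∈ U} ∪ {x : G | ∃ t : ↥T, t ∈ R ∧ IsConj (t : G) x}ᶜ := by
      ext x
      simp only [mem_preimage, mem_union, mem_setOf_eq, mem_compl_iff]
      constructor
      · intro hx
        by_cases hxΩ : x ∈ {x : G | ∃ t : ↥T, t ∈ R ∧ IsConj (t : G) x}
        · exact Or.inl ⟨hxΩ, hx⟩
        · exact Or.inr hxΩ
      · rintro (⟨-, hx⟩ | hx)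
        · exact hx
        · rw [hN0 x hx]; exact h0
    rw [heq]
    exact hA.measurableSet.union hΩ.measurableSet.compl
  · have heq : N ⁻¹' U = {x : G | x ∈ {x : G | ∃ t : ↥T, t ∈ R ∧ IsConj (t : G) x} ∧ N x ∈ U} := by
      ext x
      simp only [mem_preimage, mem_setOf_eq]
      constructor
      · intro hx
        by_cases hxΩ : x ∈ {x : G | ∃ t : ↥T, t ∈ R ∧ IsConj (t : G) x}
        · exact ⟨hxΩ, hx⟩
        · exact absurd (by rwa [hN0 x hxΩ] at hx) h0
      · rintro ⟨-, hx⟩; exact hx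
    rw [heq]
    exact hA.measurableSet

include hdich hψw hN hN0 in
/-- **BOUNDED ON A COMPACT SET** whose hyperbolic classes have regular representatives in a compact `C ⊆ T` (hypothesis (c); `ψ` continuous).
[cite: HarishChandra1970, Part I §3 Lemma 19 (Cor.)] -/
theorem exists_bound_of_isCompact (hψ : Continuous ψ) {K : Set G} {C : Set ↥T} (hC : IsCompact C)
    (hKC : ∀ x ∈ K, x ∈ {x : G | ∃ t : ↥T, t ∈ R ∧ IsConj (t : G) x} → ∃ t ∈ C, t ∈ R ∧ IsConj (t : G) x) :
    ∃ B : ℝ, ∀ x ∈ K, ‖N x‖ ≤ B := by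
  obtain ⟨B, hB⟩ := (hC.image hψ).isBounded.exists_norm_le
  refine ⟨max B 0, fun x hx => ?_⟩
  by_cases hxΩ : x ∈ {x : G | ∃ t : ↥T, t ∈ R ∧ IsConj (t : G) x}
  · obtain ⟨t, htC, hreg, hconj⟩ := hKC x hx hxΩ
    rw [apply_eq_of_isConj R w hdich ψ hψw N hN t hreg x hconj]
    exact (hB _ ⟨t, htC, rfl⟩).trans (le_max_left _ _)
  · rw [hN0 x hxΩ, norm_zero]
    exact le_max_right _ _

/-! ## §3 The package -/

open scoped Classical in
include hdich hopen hψw in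
/-- **CLASS FUNCTIONS ON THE HYPERBOLIC SET FROM `w`-SYMMETRIC TORUS FUNCTIONS (group-generic).**  Under (a) fibre dichotomy, (b) openness and (c) compact
representatives, every continuous `ψ : T → ℂ` with `ψ(w t) = ψ(t)` on `R` extends to `N : G → ℂ`: MEASURABLE, CONJUGATION INVARIANT, `= 0` off `Ω`, `= ψ` on `R`,
BOUNDED ON COMPACT SETS. [cite: HarishChandra1970, Part V §3 Thm. 12; Part I §3 Lemmas 19–20; Lemma 42] [cite: Rogawski1990, §12.5 p. 182] [cite: vanDijk1972, §2] -/
theorem exists_classFun_of_recipe [MeasurableSpace G] [BorelSpace G] (hψ : Continuous ψ)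
    (hcpt : ∀ K : Set G, IsCompact K → ∃ C : Set ↥T, IsCompact C ∧
      ∀ x ∈ K, x ∈ {x : G | ∃ t : ↥T, t ∈ R ∧ IsConj (t : G) x} → ∃ t ∈ C, t ∈ R ∧ IsConj (t : G) x) :
    ∃ N : G → ℂ, Measurable N ∧
      (∀ x : G, x ∈ {x : G | ∃ t : ↥T, t ∈ R ∧ IsConj (t : G) x} → ∀ h : G, N (h * x * h⁻¹) = N x) ∧
      (∀ x : G, x ∉ {x : G | ∃ t : ↥T, t ∈ R ∧ IsConj (t : G) x} → N x = 0) ∧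
      (∀ t : ↥T, t ∈ R → N (t : G) = ψ t) ∧
      (∀ K : Set G, IsCompact K → ∃ B : ℝ, ∀ x ∈ K, ‖N x‖ ≤ B) := by
  let N : G → ℂ := fun x => if h : x ∈ {x : G | ∃ t : ↥T, t ∈ R ∧ IsConj (t : G) x} then ψ h.choose else 0
  have hN : ∀ (x : G) (h : x ∈ {x : G | ∃ t : ↥T, t ∈ R ∧ IsConj (t : G) x}), N x = ψ h.choose := fun x h => dif_pos h
  have hN0 : ∀ x : G, x ∉ {x : G | ∃ t : ↥T, t ∈ R ∧ IsConj (t : G) x} → N x = 0 := fun x h => dif_neg h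
  refine ⟨N, measurable_of_recipe R w hdich hopen ψ hψw N hN hN0 hψ, fun x _ h => apply_conj_eq R w hdich ψ hψw N hN hN0 x h, hN0,
    fun t ht => apply_coe_eq R w hdich ψ hψw N hN t ht, fun K hK => ?_⟩
  obtain ⟨C, hC, hKC⟩ := hcpt K hK
  exact exists_bound_of_isCompact R w hdich ψ hψw N hN hN0 hψ hC hKC

end Summit.HodgeConjecture.HodgeConjecture.Cruxes.H413.K2E3HyperbolicClassFunRecipe

end
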